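/-
Copyright (c) 2026 the pub-hodgecm-mathlib formalisation cell (harness21).  Prover seat hodgecm-mathlib-K2E3-p27 (g0), HCML Track B «K2-LIT» ∕ h413
(`stmt-HodgeConjecture-24833`), line `K2_E3_EllipticInputs`, unit U12 «Characters», PART «RANK» leaf (11-2qs-Id′) ∕ (qs2-ps) «van Dijk₂», deal D117 (HCD₂)
(dealer K2E3-plan (g4)), FILE 1 OF 3 «HCD₂-LIE»: `|η|^{−1∕2} = (√√‖disc χ_X‖)⁻¹` is locally `∫⁻`-finite on the Lie algebra `𝔲(σ, Φ₂)(K) = 𝔲(1,1)` of the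
quasi-split unitary group in two variables — rank one: an explicit `F′`-chart makes `η` a non-degenerate TERNARY quadratic form, and ★ (D3b) does the analysis.  2026-09-04.
-/
import Summits.HodgeConjecture.HodgeConjecture.Theorems.F0P3cStCharTSQuadraticFormNegHalf   -- ★ (D3b) p852106: `forall_exists_nhds_setLIntegral_quadraticForm_neg_half_lt_top` (`|Q|^{−1∕2} ∈ L¹_loc(F³)`)
import Summits.HodgeConjecture.HodgeConjecture.Theorems.F0P3cStCharTSHCDCoordinates          -- ★ (CO) p8521xx: `exists_continuousOn_leftInverse`, the PAIR∕SKEW coordinate algebra `pair_*`, `skew_*`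
import Summits.HodgeConjecture.HodgeConjecture.Theorems.F0P3cStCharTSHCDCuspDocking           -- ★ (HC): `coe_sqrt_sqrt_inv_eq_rpow_neg_half_of_eq_sq` (the `√√ ↦ rpow (−1∕2)` docking); brings ★ (NB), ★ (G-FUB)
import Literature.MeasureTheory.Group.LocFiniteLIntegralProductTransfer                        -- ★ (G-FUB) p852081: `forall_exists_nhds_setLIntegral_lt_top_iff_of_prod ∕ _of_addEquiv`
import Mathlib.LinearAlgebra.Matrix.Charpoly.Disc
import HarnessLib

/-!
# Deal D117 (HCD₂), FILE 1 «HCD₂-LIE»: `(√√‖disc χ_X‖_K)⁻¹` is locally `∫⁻`-finite on `𝔲(1,1) = 𝔲(σ, Φ₂)(K)` (Harish-Chandra 1970 Part VII §1 Thm. 15 on the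
# Lie algebra, rank one)

Cell `pub/hodgecm-mathlib` (D-0151), Track B «K2-LIT», crux H413 = `stmt-HodgeConjecture-24833`, route `HCCMUnconditional`.  Lane `--supports stmt-HodgeConjecture-24833
--as helper`; THEOREMS ONLY (no `def`, no `instance`, no `notation`, no named-fact hypothesis, no `sorry`); count-neutral.  Census `K2/K2E3-p27/g0/` + bus 13:38Z.

SETTING (the frame of ★ ROAD «HC-D» (CO)).  `K` a non-archimedean local field with a ring involution `σ` (`hσ`), `2 ∈ Kˣ`; `F′` a non-archimedean local field with a
CLOSED EMBEDDING `ι : F′ →+* K` whose image is the fixed field of `σ` (`hιr`), a SKEW unit `lam` (`σ lam = −lam`) and the quadratic norm bridge `hιn : ‖ι y‖_K = ‖y‖_{F′}²`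
(★ (NB) `normAbs_map_eq_sq_of_involution` discharges it); the Lie algebra of `U(σ, Φ₂)(K)`, `Φ₂ = !![0,1;1,0]`, as an ARBITRARY additive subgroup `𝔲 ≤ M₂(K)` with
`h𝔲 : X ∈ 𝔲 ↔ (X.map σ)ᵀ Φ₂ + Φ₂ X = 0`.  In the model: `K = L_w`, `F′ = L⁺_v`, `ι = algebraMap`, `σ = σ_w`, `v` non-split, `𝔲 = 𝔲(1,1)(L⁺_v)`.

THE MATHEMATICS.  `(X.map σ)ᵀ Φ₂ + Φ₂ X = 0` says `X = (a, b; c, −σa)` with `σ b = −b`, `σ c = −c` (§1), so `X₀₀ = ι x + lam·ι y`, `X₁₁ = −ι x + lam·ι y`,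
`X₀₁ = lam·ι β`, `X₁₀ = lam·ι γ` is an `F′`-chart `Φ : (Fin 4 → F′) ≃ₜ+ ↥𝔲` (§2; inverse through a continuous left inverse of `ι`, no continuity of `σ` used — verbatim the
★ (CO) technique at `Fin 2`).  In these coordinates `disc χ_X = (tr X)² − 4 det X = 4(ι x)² + 4 X₀₁X₁₀ = ι(4(x² + m βγ))` with `lam² = ι m` (§3): a NON-DEGENERATE TERNARY
quadratic form `Q(x, β, γ) = 4x² + 4mβγ` (Gram matrix `!![4,0,0;0,0,2m;0,2m,0]`, `det = −16m² ≠ 0`) that does NOT involve the centre coordinate `y`.  By the norm bridge the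
integrand `(√√‖disc χ_X‖_K)⁻¹` reads `‖Q‖_{F′}^{−1∕2}` (§3), which is locally `∫⁻`-finite on `F′³` by ★ (D3b) `forall_exists_nhds_setLIntegral_quadraticForm_neg_half_lt_top`
(away from the null cone: locally constant; on the cone off `0`: submersion; at `0`: homogeneity, `2·(1∕2) < 3`); the idle coordinate `y` is absorbed by ★ (G-FUB) product
transfer, and the chart `Φ` by ★ (G-FUB) one-factor transfer (§4).  No Slodowy slice, no semisimple descent, no cusp docking: in rank one the only singular points of `η` on
`𝔲` are `centre + (null cone of Q)`.

* §1 `lie_two_eq_iff` (the defining equation of `𝔲(σ, Φ₂)` entrywise).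
* §2 **`exists_coords_lie_two`** — `Φ : (Fin 4 → F′) ≃ₜ+ ↥𝔲` with its four ENTRY LETTERS.
* §3 `discr_charpoly_two_of_entries` (`disc χ_X = ι(4(x² + mβγ))`), `gram_ternary_isSymm ∕ _det ∕ dotProduct_gram_ternary` (the Gram matrix of `Q`), `etaInv_coords_eq`
  (the integrand in coordinates, `rpow (−1∕2)` form).
* §4 `exists_prodChart_four` (`F′ × (Fin 3 → F′) ≃ₜ+ (Fin 4 → F′)` separating the centre coordinate), **`forall_exists_nhds_setLIntegral_etaInv_lt_top_lie_two`** — THE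
  HEAD: for every additive Haar measure `μ₀` on `↥𝔲` and every `X₀ : ↥𝔲`, `∃ U ∈ 𝓝 X₀, ∫⁻ X in U, (√√‖disc χ_X‖_K)⁻¹ ∂μ₀ < ∞`.
Consumers: FILE 2 «HCD₂-MODEL» (group ⟸ Lie through ★ `F0P3cStCharTSHCDCayleyChartAt.exists_depth_lintegral_translate_eq`, generic in the matrix size) and FILE 3 (the organ
carrier `G₂`).

HONEST LABEL: HC_CM is proved only modulo the 7 printed citations (2 remaining named inputs: hLiu418 = stmt-HodgeConjecture-24832, h413 = stmt-HodgeConjecture-24833) until rung 0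
closes; count-neutral helper of the (qs2-ps) ∕ (11-2qs-Id′) by-class road; nothing printed is asserted as a fact.

## References
* [HarishChandra1970] Harish-Chandra (notes by G. van Dijk), *Harmonic analysis on reductive p-adic groups*, LNM 162 (1970), Part VII §1 Thm. 15 (`|D|^{−1∕2} ∈ L¹_loc`;
  on the Lie algebra `|η|^{−1∕2}`), §7.
* [Rogawski1990] J. D. Rogawski, *Automorphic Representations of Unitary Groups in Three Variables*, Ann. of Math. Stud. 123 (1990), §1.9 p. 13 (`U(1,1)`), §4.9 p. 54.
* [PlatonovRapinchuk1994] V. Platonov, A. Rapinchuk, *Algebraic Groups and Number Theory* (1994), §2.3.3 (unitary Lie algebras over quadratic extensions), §3.3.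
* [WeilBNT1967] A. Weil, *Basic Number Theory* (1967), Ch. I §2, Ch. II §1 (Haar measure on `Kⁿ`).
-/

set_option autoImplicit false
-- the mandated namespace repeats the single-problem summit's segment (`HodgeConjecture.HodgeConjecture`)
set_option linter.dupNamespace false

noncomputable section

open MeasureTheory MeasureTheory.Measure Filter Topology Set Matrix
open scoped ENNReal NNReal
open Literature.NumberTheory.GaloisRepresentations Literature.NumberTheory.GaloisRepresentations.IsNonarchimedeanLocalField
open Literature.NumberTheory.Automorphic Literature.NumberTheory.Automorphic.LocalFieldHaar Literature.MeasureTheory.Group Literature.NumberTheory.LocalFields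
open Summit.HodgeConjecture.HodgeConjecture.Cruxes.H413.F0P3cStCharTSHCDCoordinates
open Summit.HodgeConjecture.HodgeConjecture.Cruxes.H413.F0P3cStCharTSQuadraticFormNegHalf (forall_exists_nhds_setLIntegral_quadraticForm_neg_half_lt_top)
open Summit.HodgeConjecture.HodgeConjecture.Cruxes.H413.F0P3cStCharTSHCDCuspDocking (coe_sqrt_sqrt_inv_eq_rpow_neg_half_of_eq_sq)

namespace Summit.HodgeConjecture.HodgeConjecture.Cruxes.H413.K2E3U11WeylDiscrLieLocInt

/-! ## §1 The defining equation of `𝔲(σ, Φ₂)` entrywise -/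

section Algebra

variable {K : Type*} [Field K] (σ : K →+* K)

/-- **`(X.map σ)ᵀ Φ₂ + Φ₂ X = 0` entrywise** (`Φ₂ = !![0,1;1,0]`): entry `(i, j)` of the left side is `σ X_{1−j, i} + X_{1−i, j}`; so `X ∈ 𝔲(σ, Φ₂)` iff `X₁₀`, `X₀₁` are SKEW
and `X₁₁ = −σ X₀₀`. [cite: Rogawski1990, §1.9 p. 13] [cite: PlatonovRapinchuk1994, §2.3.3] -/
theorem lie_two_eq_iff (X : Matrix (Fin 2) (Fin 2) K) :
    (X.map σ)ᵀ * !![(0 : K), 1; 1, 0] + !![(0 : K), 1; 1, 0] * X = 0 ↔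
      (σ (X 1 0) + X 1 0 = 0 ∧ σ (X 0 0) + X 1 1 = 0) ∧ (σ (X 1 1) + X 0 0 = 0 ∧ σ (X 0 1) + X 0 1 = 0) := by
  rw [← Matrix.ext_iff]
  simp only [Fin.forall_fin_succ, Matrix.add_apply, Matrix.mul_apply, Matrix.transpose_apply, Matrix.map_apply,
    Fin.sum_univ_two, Matrix.zero_apply]
  simp [Fin.succ_zero_eq_one]

/-- **The discriminant of the characteristic polynomial of a `2 × 2` matrix of `𝔲(σ, Φ₂)`-shape in `F′`-coordinates**: for
`X = !![ι x + lam·ι y, lam·ι β; lam·ι γ, −ι x + lam·ι y]` and `lam² = ι m`, `disc χ_X = (tr X)² − 4 det X = ι(4(x² + m(βγ)))` — a ternary quadratic form in `(x, β, γ)` NOT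
involving the centre coordinate `y`. [cite: HarishChandra1970, Part VII §7] [cite: Rogawski1990, §4.9 p. 54] -/
theorem discr_charpoly_two_of_entries {F' : Type*} [CommRing F'] (ι : F' →+* K) (lam : Kˣ) {m : F'} (hm : ι m = (lam : K) ^ 2) (x y β γ : F') :
    (Matrix.charpoly !![ι x + (lam : K) * ι y, (lam : K) * ι β; (lam : K) * ι γ, -ι x + (lam : K) * ι y]).discr = ι (4 * (x ^ 2 + m * (β * γ))) := by
  rw [← Matrix.discr, Matrix.discr_fin_two, Matrix.trace_fin_two_of, Matrix.det_fin_two_of]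
  simp only [map_mul, map_add, map_pow, map_ofNat, hm]
  ring

end Algebra

/-! ## §2 The chart `Φ : (Fin 4 → F′) ≃ₜ+ ↥𝔲` -/

section Charts

variable {K : Type*} [Field K] [TopologicalSpace K] [IsTopologicalRing K]
  (σ : K →+* K) (hσ : ∀ x, σ (σ x) = x) [Invertible (2 : K)]
  {F' : Type*} [Field F'] [TopologicalSpace F']
  (ι : F' →+* K) (hι : IsClosedEmbedding ι) (hιr : ∀ x, σ x = x ↔ x ∈ Set.range ι)
  (lam : Kˣ) (hlam : σ lam = -lam)

include hσ hι hιr hlam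

/-- **The coordinate chart of `𝔲 = 𝔲(σ, Φ₂)(K)`**: an explicit `Φ : (Fin 4 → F′) ≃ₜ+ ↥𝔲` with entries `X₀₀ = ι a₀ + lam·ι a₁`, `X₁₁ = −ι a₀ + lam·ι a₁` (the PAIR),
`X₀₁ = lam·ι a₂`, `X₁₀ = lam·ι a₃` (SKEW) — verbatim the ★ (CO) construction at `Fin 2`: the inverse reads the fixed part `(X₀₀ − X₁₁)∕2` and the skew parts
`(X₀₀ + X₁₁)∕(2·lam)`, `X₀₁∕lam`, `X₁₀∕lam` through a continuous left inverse of `ι` on `range ι`. [cite: PlatonovRapinchuk1994, §2.3.3] [cite: Rogawski1990, §1.9 p. 13] -/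
theorem exists_coords_lie_two (𝔲 : AddSubgroup (Matrix (Fin 2) (Fin 2) K)) (h𝔲 : ∀ X, X ∈ 𝔲 ↔ (X.map σ)ᵀ * !![(0 : K), 1; 1, 0] + !![(0 : K), 1; 1, 0] * X = 0) :
    ∃ Φ : (Fin 4 → F') ≃ₜ+ ↥𝔲, ∀ a : Fin 4 → F',
      ((Φ a : ↥𝔲) : Matrix (Fin 2) (Fin 2) K) = !![ι (a 0) + (lam : K) * ι (a 1), (lam : K) * ι (a 2); (lam : K) * ι (a 3), -ι (a 0) + (lam : K) * ι (a 1)] := by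
  obtain ⟨g, hg, hgc⟩ := exists_continuousOn_leftInverse ι hι
  have hισ : ∀ a, σ (ι a) = ι a := fun a => (hιr _).2 ⟨a, rfl⟩
  have hfix : ∀ x : K, σ x = x → ι (g x) = x := fun x hx => by
    obtain ⟨a, rfl⟩ := (hιr x).1 hx; rw [hg]
  have hιc : Continuous ι := hι.continuous
  -- the forward matrix
  set M : (Fin 4 → F') → Matrix (Fin 2) (Fin 2) K := fun a =>
    !![ι (a 0) + (lam : K) * ι (a 1), (lam : K) * ι (a 2); (lam : K) * ι (a 3), -ι (a 0) + (lam : K) * ι (a 1)] with hM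
  have hMmem : ∀ a, M a ∈ 𝔲 := fun a => by
    rw [h𝔲, lie_two_eq_iff]
    simp only [hM, Matrix.of_apply, Matrix.cons_val', Matrix.cons_val_zero, Matrix.cons_val_one,
      Matrix.empty_val', Matrix.cons_val_fin_one, map_add, map_neg, map_mul, hισ, hlam]
    refine ⟨⟨by ring, by ring⟩, ⟨by ring, by ring⟩⟩
  -- the backward coordinates
  set N : Matrix (Fin 2) (Fin 2) K → (Fin 4 → F') := fun X =>
    ![g ((X 0 0 - X 1 1) * ⅟(2 : K)), g ((X 0 0 + X 1 1) * ⅟(2 : K) * ((lam⁻¹ : Kˣ) : K)),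
      g (X 0 1 * ((lam⁻¹ : Kˣ) : K)), g (X 1 0 * ((lam⁻¹ : Kˣ) : K))] with hN
  -- left inverse
  have hNM : ∀ a, N (M a) = a := fun a => by
    funext k
    fin_cases k <;>
      simp only [hN, hM, Matrix.of_apply, Matrix.cons_val', Matrix.cons_val_zero, Matrix.cons_val_one,
        Matrix.empty_val', Matrix.cons_val_fin_one, Fin.isValue, Fin.mk_zero, Fin.mk_one, Fin.reduceFinMk,
        Matrix.cons_val, pair_fst, pair_snd, skew_coord, hg]
  -- right inverse on `𝔲`
  have hMN : ∀ X ∈ 𝔲, M (N X) = X := fun X hX => by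
    rw [h𝔲, lie_two_eq_iff] at hX
    obtain ⟨⟨h10, h00⟩, ⟨h11, h01⟩⟩ := hX
    have f0 := hfix _ (pair_fst_fixed σ hσ h00)
    have f1 := hfix _ (pair_snd_fixed σ hσ lam hlam h00)
    have f2 := hfix _ (skew_fixed σ lam hlam h01)
    have f3 := hfix _ (skew_fixed σ lam hlam h10)
    ext i j
    fin_cases i <;> fin_cases j <;>
      simp only [hM, hN, Matrix.of_apply, Matrix.cons_val', Matrix.cons_val_zero, Matrix.cons_val_one,
        Matrix.empty_val', Matrix.cons_val_fin_one, Fin.isValue, Fin.mk_zero, Fin.mk_one,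
        Matrix.cons_val, f0, f1, f2, f3] <;>
      first
        | exact pair_recombine_fst lam _ _
        | exact pair_recombine_snd lam _ _
        | exact skew_recombine lam _
  -- continuity
  have hMc : Continuous M := by
    refine continuous_matrix fun i j => ?_
    fin_cases i <;> fin_cases j <;>
      simp only [hM, Matrix.of_apply, Matrix.cons_val', Matrix.cons_val_zero, Matrix.cons_val_one,
        Matrix.empty_val', Matrix.cons_val_fin_one, Fin.isValue, Fin.mk_zero, Fin.mk_one] <;>
      fun_prop
  have hNc : Continuous fun X : ↥𝔲 => N (X : Matrix (Fin 2) (Fin 2) K) := by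
    refine continuous_pi fun k => ?_
    have hent : ∀ i j, Continuous fun X : ↥𝔲 => (X : Matrix (Fin 2) (Fin 2) K) i j :=
      fun i j => (continuous_apply j).comp ((continuous_apply i).comp continuous_subtype_val)
    have hmem : ∀ X : ↥𝔲, (((X : Matrix (Fin 2) (Fin 2) K).map σ)ᵀ * !![(0 : K), 1; 1, 0] + !![(0 : K), 1; 1, 0] * (X : Matrix (Fin 2) (Fin 2) K) = 0) :=
      fun X => (h𝔲 _).1 X.2
    fin_cases k <;>
      simp only [hN, Matrix.cons_val_zero, Matrix.cons_val_one, Fin.isValue, Fin.mk_zero, Fin.mk_one, Fin.reduceFinMk, Matrix.cons_val]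
    · exact hgc.comp_continuous ((hent 0 0).sub (hent 1 1) |>.mul continuous_const) fun X =>
        (hιr _).1 (pair_fst_fixed σ hσ ((lie_two_eq_iff σ _).1 (hmem X)).1.2)
    · exact hgc.comp_continuous (((hent 0 0).add (hent 1 1) |>.mul continuous_const).mul continuous_const) fun X =>
        (hιr _).1 (pair_snd_fixed σ hσ lam hlam ((lie_two_eq_iff σ _).1 (hmem X)).1.2)
    · exact hgc.comp_continuous ((hent 0 1).mul continuous_const) fun X =>
        (hιr _).1 (skew_fixed σ lam hlam ((lie_two_eq_iff σ _).1 (hmem X)).2.2)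
    · exact hgc.comp_continuous ((hent 1 0).mul continuous_const) fun X =>
        (hιr _).1 (skew_fixed σ lam hlam ((lie_two_eq_iff σ _).1 (hmem X)).1.1)
  -- additivity
  have hMadd : ∀ a b, M (a + b) = M a + M b := fun a b => by
    ext i j
    fin_cases i <;> fin_cases j <;>
      simp only [hM, Matrix.add_apply, Pi.add_apply, Matrix.of_apply, Matrix.cons_val', Matrix.cons_val_zero, Matrix.cons_val_one,
        Matrix.empty_val', Matrix.cons_val_fin_one, Fin.isValue, Fin.mk_zero, Fin.mk_one,
        map_add] <;> ring
  -- assemble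
  let Φ : (Fin 4 → F') ≃ₜ+ ↥𝔲 :=
    { toFun := fun a => ⟨M a, hMmem a⟩
      invFun := fun X => N (X : Matrix (Fin 2) (Fin 2) K)
      left_inv := fun a => hNM a
      right_inv := fun X => Subtype.ext (hMN X.1 X.2)
      map_add' := fun a b => Subtype.ext (hMadd a b)
      continuous_toFun := hMc.subtype_mk _
      continuous_invFun := hNc }
  exact ⟨Φ, fun a => rfl⟩

end Charts

/-! ## §3 The ternary quadratic form `Q(x, β, γ) = 4x² + 4mβγ` and the integrand in coordinates -/

section Ternary

variable {F' : Type*} [Field F']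

/-- The Gram matrix `!![4,0,0;0,0,2m;0,2m,0]` of `Q` is symmetric. [cite: WeilBNT1967, Ch. II §1] -/
theorem gram_ternary_isSymm (m : F') : (!![(4 : F'), 0, 0; 0, 0, 2 * m; 0, 2 * m, 0]).IsSymm := by
  refine Matrix.IsSymm.ext fun i j => ?_
  fin_cases i <;> fin_cases j <;> rfl

/-- `det !![4,0,0;0,0,2m;0,2m,0] = −16 m²`. [cite: WeilBNT1967, Ch. II §1] -/
theorem gram_ternary_det (m : F') : (!![(4 : F'), 0, 0; 0, 0, 2 * m; 0, 2 * m, 0]).det = -(16 * m ^ 2) := by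
  rw [Matrix.det_fin_three]
  simp only [Matrix.of_apply, Matrix.cons_val', Matrix.cons_val_zero, Matrix.cons_val_one, Matrix.cons_val_two, Matrix.tail_cons,
    Matrix.empty_val', Matrix.cons_val_fin_one, Matrix.head_cons, Matrix.head_fin_const]
  ring

/-- `det !![4,0,0;0,0,2m;0,2m,0] ≠ 0` when `m ≠ 0` and `2 ≠ 0`. [cite: WeilBNT1967, Ch. II §1] -/
theorem gram_ternary_det_ne_zero {m : F'} (hm : m ≠ 0) (h2 : (2 : F') ≠ 0) : (!![(4 : F'), 0, 0; 0, 0, 2 * m; 0, 2 * m, 0]).det ≠ 0 := by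
  rw [gram_ternary_det]
  have h16 : (16 : F') ≠ 0 := by
    have : (16 : F') = 2 ^ 4 := by norm_num
    rw [this]; exact pow_ne_zero 4 h2
  exact neg_ne_zero.2 (mul_ne_zero h16 (pow_ne_zero 2 hm))

/-- `y ⬝ᵥ !![4,0,0;0,0,2m;0,2m,0] *ᵥ y = 4(y₀² + m(y₁y₂))`. [cite: WeilBNT1967, Ch. II §1] -/
theorem dotProduct_gram_ternary (m : F') (y : Fin 3 → F') :
    y ⬝ᵥ !![(4 : F'), 0, 0; 0, 0, 2 * m; 0, 2 * m, 0] *ᵥ y = 4 * (y 0 ^ 2 + m * (y 1 * y 2)) := by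
  simp only [Matrix.mulVec, dotProduct, Fin.sum_univ_three, Matrix.of_apply, Matrix.cons_val', Matrix.cons_val_zero, Matrix.cons_val_one,
    Matrix.cons_val_two, Matrix.tail_cons, Matrix.empty_val', Matrix.cons_val_fin_one, Matrix.head_cons, Matrix.head_fin_const]
  ring

end Ternary

section Integrand

variable {K : Type*} [Field K] [ValuativeRel K] [TopologicalSpace K] [IsNonarchimedeanLocalField K]
  {F' : Type*} [Field F'] [ValuativeRel F'] [TopologicalSpace F'] [IsNonarchimedeanLocalField F']

/-- **The integrand in coordinates**: if `↑(Φ a) = !![ι a₀ + lam·ι a₁, lam·ι a₂; lam·ι a₃, −ι a₀ + lam·ι a₁]`, `lam² = ι m` and `‖ι y‖_K = ‖y‖_{F′}²`, then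
`(√√‖disc χ_{Φ a}‖_K)⁻¹ = ‖4(a₀² + m a₂a₃)‖_{F′}^{−1∕2}` (§1 + the `√√ ↦ rpow` docking ★ `coe_sqrt_sqrt_inv_eq_rpow_neg_half_of_eq_sq`).
[cite: WeilBNT1967, Ch. I §2 Cor. 3 of Thm. 3] [cite: HarishChandra1970, Part VII §7] -/
theorem etaInv_coords_eq (ι : F' →+* K) (hιn : ∀ y : F', normAbs K (ι y) = normAbs F' y ^ 2) (lam : Kˣ) {m : F'} (hm : ι m = (lam : K) ^ 2)
    {𝔲 : AddSubgroup (Matrix (Fin 2) (Fin 2) K)} (Φ : (Fin 4 → F') ≃ₜ+ ↥𝔲)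
    (hΦ : ∀ a : Fin 4 → F', ((Φ a : ↥𝔲) : Matrix (Fin 2) (Fin 2) K) =
      !![ι (a 0) + (lam : K) * ι (a 1), (lam : K) * ι (a 2); (lam : K) * ι (a 3), -ι (a 0) + (lam : K) * ι (a 1)])
    (a : Fin 4 → F') :
    ((NNReal.sqrt (NNReal.sqrt (normAbs K (Matrix.charpoly ((Φ a : ↥𝔲) : Matrix (Fin 2) (Fin 2) K)).discr)) : ℝ≥0∞))⁻¹ =
      ((normAbs F' (4 * (a 0 ^ 2 + m * (a 2 * a 3))) : ℝ≥0∞)) ^ (-(1 / 2 : ℝ)) := by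
  rw [hΦ a, discr_charpoly_two_of_entries ι lam hm]
  exact coe_sqrt_sqrt_inv_eq_rpow_neg_half_of_eq_sq (hιn _)

end Integrand

/-! ## §4 The centre coordinate is idle: product chart, and THE HEAD -/

section Head

/-- **The product chart separating the centre coordinate**: `e : F′ × (Fin 3 → F′) ≃ₜ+ (Fin 4 → F′)`, `e (z, y) = (y₀, z, y₁, y₂)` (so that the integrand of §3, which does not
involve the coordinate of index `1`, factors through the second projection). [cite: Folland1999, §2.5 Thm. 2.37] -/
theorem exists_prodChart_four (F' : Type*) [AddCommGroup F'] [TopologicalSpace F'] [IsTopologicalAddGroup F'] :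
    ∃ e : F' × (Fin 3 → F') ≃ₜ+ (Fin 4 → F'), ∀ (z : F') (y : Fin 3 → F'), e (z, y) = ![y 0, z, y 1, y 2] := by
  let e : F' × (Fin 3 → F') ≃ₜ+ (Fin 4 → F') :=
    { toFun := fun p => ![p.2 0, p.1, p.2 1, p.2 2]
      invFun := fun c => (c 1, ![c 0, c 2, c 3])
      left_inv := fun p => by
        obtain ⟨z, y⟩ := p
        refine Prod.ext rfl ?_
        funext k
        fin_cases k <;> rfl
      right_inv := fun c => by
        funext k
        fin_cases k <;> rfl
      map_add' := fun p q => by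
        funext k
        fin_cases k <;> rfl
      continuous_toFun := by
        refine continuous_pi fun k => ?_
        fin_cases k <;>
          simp only [Fin.isValue, Fin.mk_zero, Fin.mk_one, Fin.reduceFinMk, Matrix.cons_val_zero, Matrix.cons_val_one, Matrix.cons_val_two,
            Matrix.cons_val_three, Matrix.tail_cons, Matrix.head_cons] <;>
          fun_prop
      continuous_invFun := by
        refine (continuous_apply 1).prodMk (continuous_pi fun k => ?_)
        fin_cases k <;>
          simp only [Fin.isValue, Fin.mk_zero, Fin.mk_one, Fin.reduceFinMk, Matrix.cons_val_zero, Matrix.cons_val_one, Matrix.cons_val_two,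
            Matrix.tail_cons, Matrix.head_cons] <;>
          fun_prop }
  exact ⟨e, fun z y => rfl⟩

/-- **THE HEAD (HCD₂-LIE) — `(√√‖disc χ_X‖_K)⁻¹` IS LOCALLY `∫⁻`-FINITE ON `𝔲(σ, Φ₂)(K) = 𝔲(1,1)`** at EVERY point, for EVERY additive Haar measure `μ₀` on `↥𝔲` (frame of the
module docstring: `σ` an involution of the local field `K` with fixed field `ι(F′)`, `ι` a closed embedding, `lam` a skew unit, `hιn` the quadratic norm bridge, `2 ∈ Kˣ`).
PROOF: the chart `Φ` of §2 reads the integrand as `‖4(x² + mβγ)‖_{F′}^{−1∕2}` (§3), independent of the centre coordinate; ★ (D3b) `|Q|^{−1∕2} ∈ L¹_loc(F′³)` for the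
non-degenerate ternary form `Q` (Gram matrix `!![4,0,0;0,0,2m;0,2m,0]`, `det = −16m² ≠ 0`); ★ (G-FUB) product transfer absorbs the idle coordinate and ★ (G-FUB) one-factor
transfer moves the statement onto `↥𝔲` along `Φ` (Haar uniqueness absorbs all constants). [cite: HarishChandra1970, Part VII §1 Thm. 15, §7] [cite: WeilBNT1967, Ch. II §1]
[cite: Folland1999, §2.5 Thm. 2.37, §11.1 Thm. 11.9] -/
theorem forall_exists_nhds_setLIntegral_etaInv_lt_top_lie_two
    {K : Type*} [Field K] [ValuativeRel K] [TopologicalSpace K] [IsNonarchimedeanLocalField K]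
    (σ : K →+* K) (hσ : ∀ x, σ (σ x) = x) [Invertible (2 : K)]
    {F' : Type*} [Field F'] [ValuativeRel F'] [TopologicalSpace F'] [IsNonarchimedeanLocalField F']
    (ι : F' →+* K) (hι : IsClosedEmbedding ι) (hιr : ∀ x, σ x = x ↔ x ∈ Set.range ι) (lam : Kˣ) (hlam : σ lam = -lam)
    (hιn : ∀ y : F', normAbs K (ι y) = normAbs F' y ^ 2)
    (𝔲 : AddSubgroup (Matrix (Fin 2) (Fin 2) K)) (h𝔲 : ∀ X, X ∈ 𝔲 ↔ (X.map σ)ᵀ * !![(0 : K), 1; 1, 0] + !![(0 : K), 1; 1, 0] * X = 0)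
    [MeasurableSpace ↥𝔲] [BorelSpace ↥𝔲] (μ₀ : Measure ↥𝔲) [μ₀.IsAddHaarMeasure] :
    ∀ X₀ : ↥𝔲, ∃ U ∈ 𝓝 X₀, ∫⁻ X in U,
      ((NNReal.sqrt (NNReal.sqrt (normAbs K (Matrix.charpoly (X : Matrix (Fin 2) (Fin 2) K)).discr)) : ℝ≥0∞))⁻¹ ∂μ₀ < ∞ := by
  classical
  -- ===== instances on the coordinate field `F′` =====
  haveI : T2Space F' := (isLocalField F').toT2Space
  haveI := secondCountableTopology_localField F'
  letI : MeasurableSpace F' := borel F'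
  haveI : BorelSpace F' := ⟨rfl⟩
  -- ===== the square of the skew unit is fixed: `lam² = ι m`, `m ≠ 0`; `2 ≠ 0` in `F′` =====
  obtain ⟨m, hm⟩ : ∃ m : F', ι m = (lam : K) ^ 2 := by
    obtain ⟨m, hm⟩ := (hιr ((lam : K) ^ 2)).1 (by rw [map_pow, hlam, neg_sq])
    exact ⟨m, hm⟩
  have hm0 : m ≠ 0 := by
    rintro rfl
    rw [map_zero] at hm
    exact (pow_ne_zero 2 lam.ne_zero) hm.symm
  have h2F : (2 : F') ≠ 0 := fun h => (Invertible.ne_zero (2 : K)) (by rw [← map_ofNat ι 2, h, map_zero])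
  -- ===== the chart and the instances on `↥𝔲` it transports =====
  obtain ⟨Φ, hΦ⟩ := exists_coords_lie_two σ hσ ι hι hιr lam hlam 𝔲 h𝔲
  haveI : LocallyCompactSpace ↥𝔲 := Φ.toHomeomorph.symm.isClosedEmbedding.locallyCompactSpace
  haveI : SecondCountableTopology ↥𝔲 := Φ.toHomeomorph.symm.secondCountableTopology
  -- ===== Haar measures on the coordinate spaces =====
  set μ : Measure F' := Measure.addHaar with hμ
  haveI : (Measure.pi fun _ : Fin 4 => μ).IsAddHaarMeasure := Measure.pi.isAddHaarMeasure _
  haveI : (Measure.pi fun _ : Fin 3 => μ).IsAddHaarMeasure := Measure.pi.isAddHaarMeasure _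
  -- ===== the three integrands =====
  set f : ↥𝔲 → ℝ≥0∞ := fun X =>
    ((NNReal.sqrt (NNReal.sqrt (normAbs K (Matrix.charpoly (X : Matrix (Fin 2) (Fin 2) K)).discr)) : ℝ≥0∞))⁻¹ with hfdef
  set g₄ : (Fin 4 → F') → ℝ≥0∞ := fun a => ((normAbs F' (4 * (a 0 ^ 2 + m * (a 2 * a 3))) : ℝ≥0∞)) ^ (-(1 / 2 : ℝ)) with hg₄
  set g₃ : (Fin 3 → F') → ℝ≥0∞ := fun y =>
    ((normAbs F' (y ⬝ᵥ !![(4 : F'), 0, 0; 0, 0, 2 * m; 0, 2 * m, 0] *ᵥ y) : ℝ≥0∞)) ^ (-(1 / 2 : ℝ)) with hg₃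
  have hfΦ : ∀ a : Fin 4 → F', f (Φ a) = g₄ a := fun a => etaInv_coords_eq ι hιn lam hm Φ hΦ a
  have hg₃m : Measurable g₃ := by
    have hQc : Continuous fun y : Fin 3 → F' => y ⬝ᵥ !![(4 : F'), 0, 0; 0, 0, 2 * m; 0, 2 * m, 0] *ᵥ y :=
      continuous_id.dotProduct (continuous_const.matrix_mulVec continuous_id)
    exact ((measurable_normAbs.comp hQc.measurable).coe_nnreal_ennreal).pow_const _
  -- ===== ★ (D3b): `|Q|^{−1∕2} ∈ L¹_loc(F′³)` =====
  have hD3b := forall_exists_nhds_setLIntegral_quadraticForm_neg_half_lt_top μ (gram_ternary_isSymm m) (gram_ternary_det_ne_zero hm0 h2F) h2F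
  -- ===== the idle centre coordinate: product transfer =====
  obtain ⟨e, he⟩ := exists_prodChart_four F'
  have hfg : ∀ (z : F') (y : Fin 3 → F'), g₄ (e (z, y)) = g₃ y := fun z y => by
    simp only [hg₄, hg₃, he, dotProduct_gram_ternary, Matrix.cons_val_zero, Matrix.cons_val_two, Matrix.tail_cons, Matrix.head_cons,
      Matrix.cons_val_three]
  have h4 : ∀ a : Fin 4 → F', ∃ U ∈ 𝓝 a, ∫⁻ x in U, g₄ x ∂(Measure.pi fun _ : Fin 4 => μ) < ∞ :=
    (forall_exists_nhds_setLIntegral_lt_top_iff_of_prod e (Measure.pi fun _ : Fin 3 => μ) (Measure.pi fun _ : Fin 4 => μ) μ hg₃m hfg).2 hD3b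
  -- ===== transfer along the chart `Φ` =====
  refine (forall_exists_nhds_setLIntegral_lt_top_iff_of_addEquiv Φ (Measure.pi fun _ : Fin 4 => μ) μ₀ f).2 fun a => ?_
  obtain ⟨U, hU, hfin⟩ := h4 a
  refine ⟨U, hU, ?_⟩
  have hcongr : ∫⁻ v in U, f (Φ v) ∂(Measure.pi fun _ : Fin 4 => μ) = ∫⁻ v in U, g₄ v ∂(Measure.pi fun _ : Fin 4 => μ) :=
    lintegral_congr fun v => hfΦ v
  rw [hcongr]
  exact hfin

end Head

end Summit.HodgeConjecture.HodgeConjecture.Cruxes.H413.K2E3U11WeylDiscrLieLocInt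

end
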